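import Mathlib
import Summits.NavierStokesRegularity.NavierStokesRegularity.Theorems.EulerZoomLiouvillePowerGaugeEulerLiouvilleSelfSimilarEndpointSobolevTools
import HarnessLib

/-!
# Rung C1 of the crux `EulerZoomLiouville.PowerGaugeEulerLiouville` at the endpoint `ρ = 1/2`:
# Sobolev growth of `∫_{B_R} ‖V‖⁶` and `∫_{B_R} ‖V‖³` from the weak-gradient bound

Route №10 `EulerZoomLiouville` (NavierStokesRegularity), crux E = stmt-NavierStokesRegularity-19832,
registered open stub `stub_selfSimilarWeakRest`, endpoint `ρ = 1/2`.  For a profile `V ∈ L²(ℝ³)` with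
a weak gradient `G` satisfying `∫_{B_R} |G|²_F ≤ C_G R^{1/2}` (`R ≥ 1`; every endpoint member of
Seregin's class, `∫ |G|²_F |y|^{−1/2} ≤ c/5`), the scale-invariant Sobolev inequality
(`EndpointSobolev.exists_sobolev_six_ball`, `…SobolevTools`) gives

* `EndpointSobolev.exists_integral_norm_pow_six_ball_le` — `‖V‖⁶ ∈ L¹(B_R)` and
  `∫_{B_R} ‖V‖⁶ ≤ N6 R^{3/2}` for all `R ≥ 1`;
* `EndpointSobolev.exists_setIntegral_cube_ball_le` — `∫_{B_L} ‖V‖³ ≤ A L^{3−4/3}` for `L ≥ 1`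
  (indeed `≲ L^{3/8}`): the velocity-growth input (`σ = 4/3`) of the Riesz identification
  `pressure_ae_eq_scaleQ_of_poisson`, obtained in the tree from the sublinear pointwise bound
  (`setIntegral_cube_le_of_sublinear`) and here from the weak gradient;
* bookkeeping `rpow_three_eighths_div`, `rpow_quarter_mul`, `memLp_indicator_four_of_integrableOn`.

WHAT THIS IS NOT: not NS, not E, not the stub — tools for the growth-free endpoint drain
(`…SelfSimilarEndpointSobolevDecay`). [folklore]
-/

noncomputable section

-- flat `Theorems/<Route><Decl>…` files of one crux share the namespace of the crux (tree convention)
set_option linter.dupNamespace false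

open MeasureTheory Set Filter Topology Metric Function Finset TopologicalSpace
open scoped ENNReal NNReal

namespace Summit.NavierStokesRegularity.NavierStokesRegularity.Theorems.PowerGaugeEulerLiouville

open Literature.Analysis Literature.Analysis.FluidPDE Literature.Analysis.FunctionSpaces

namespace EndpointSobolev

section Helpers

variable {V : EuclideanSpace ℝ (Fin 3) → EuclideanSpace ℝ (Fin 3)}

/-- Exponent bookkeeping: `L^{3/8} / L = L^{−5/8}` (`L > 0`). [folklore] -/
theorem rpow_three_eighths_div {L : ℝ} (hL : 0 < L) :
    L ^ (3 / 8 : ℝ) / L = L ^ (-(5 / 8 : ℝ)) := by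
  rw [show (-(5 / 8 : ℝ)) = 3 / 8 - 1 by norm_num, Real.rpow_sub_one hL.ne']

/-- `V·1_T ∈ L⁴` when `‖V‖⁴ ∈ L¹(T)`. [folklore] -/
theorem memLp_indicator_four_of_integrableOn (hVm : AEStronglyMeasurable V volume)
    {T : Set (EuclideanSpace ℝ (Fin 3))} (hT : MeasurableSet T)
    (h4 : IntegrableOn (fun y => ‖V y‖ ^ 4) T volume) : MemLp (T.indicator V) 4 volume := by
  rw [memLp_indicator_iff_restrict hT,
    ← integrable_norm_rpow_iff hVm.restrict (by norm_num) (by norm_num)]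
  refine h4.congr_fun (fun y _ => ?_) hT
  rw [ENNReal.toReal_ofNat]
  norm_cast

/-- Monotonicity bookkeeping: `(N⁶ L^{3/2})^{1/4} = (N⁶)^{1/4} L^{3/8}` (`N⁶, L ≥ 0`). [folklore] -/
theorem rpow_quarter_mul {A L : ℝ} (hA : 0 ≤ A) (hL : 0 ≤ L) :
    (A * L ^ (3 / 2 : ℝ)) ^ (1 / 4 : ℝ) = A ^ (1 / 4 : ℝ) * L ^ (3 / 8 : ℝ) := by
  rw [Real.mul_rpow hA (Real.rpow_nonneg hL _), ← Real.rpow_mul hL]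
  norm_num

end Helpers

section SobolevGrowth

variable {V : EuclideanSpace ℝ (Fin 3) → EuclideanSpace ℝ (Fin 3)}

/-- **`∫_{B_R} ‖V‖⁶ ≲ R^{3/2}` for an `L²` field whose weak gradient has `∫_{B_R}|G|²_F ≤ C_G R^{1/2}`**
(`R ≥ 1`): the scale-invariant Sobolev inequality `exists_sobolev_six_ball` with
`R⁻¹ √(∫‖V‖²) + √(C_G R^{1/2}) ≤ (√(∫‖V‖²) + √C_G) R^{1/4}`. [folklore] -/
theorem exists_integral_norm_pow_six_ball_le
    {G : EuclideanSpace ℝ (Fin 3) → EuclideanSpace ℝ (Fin 3) →L[ℝ] EuclideanSpace ℝ (Fin 3)}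
    (hW : HasWeakFDerivOn (⊤ : Opens (EuclideanSpace ℝ (Fin 3))) volume V G)
    (hVm : AEStronglyMeasurable V volume) (hGm : AEStronglyMeasurable G volume)
    (hV2 : Integrable (fun z => ‖V z‖ ^ 2) volume) {C_G : ℝ} (hCG : 0 ≤ C_G)
    (hGB : ∀ R : ℝ, 1 ≤ R →
      (∫⁻ y in ball (0 : EuclideanSpace ℝ (Fin 3)) R, ENNReal.ofReal (frobeniusNormSq (G y))) ≤
        ENNReal.ofReal (C_G * R ^ (1 / 2 : ℝ))) :
    ∃ N6 : ℝ, 0 ≤ N6 ∧ ∀ R : ℝ, 1 ≤ R →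
      IntegrableOn (fun y => ‖V y‖ ^ 6) (ball (0 : EuclideanSpace ℝ (Fin 3)) R) volume ∧
      ∫ y in ball (0 : EuclideanSpace ℝ (Fin 3)) R, ‖V y‖ ^ 6 ≤ N6 * R ^ (3 / 2 : ℝ) := by
  obtain ⟨C₆, hC₆0, hSob⟩ := exists_sobolev_six_ball
  set E₂ : ℝ := ∫ z, ‖V z‖ ^ 2 with hE₂
  set N : ℝ := C₆ * (Real.sqrt E₂ + Real.sqrt C_G) with hN
  have hN0 : 0 ≤ N := by positivity
  refine ⟨N ^ 6, by positivity, fun R hR => ?_⟩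
  have hR0 : 0 < R := one_pos.trans_le hR
  have hM0 : 0 ≤ C_G * R ^ (1 / 2 : ℝ) := by positivity
  obtain ⟨hI6, hq⟩ := hSob V G hW hVm hGm hV2 R _ hR0 hM0 (hGB R hR)
  refine ⟨hI6, hq.trans ?_⟩
  have hR14 : 1 ≤ R ^ (1 / 4 : ℝ) := Real.one_le_rpow hR (by norm_num)
  have hb1 : R⁻¹ * Real.sqrt E₂ ≤ Real.sqrt E₂ * R ^ (1 / 4 : ℝ) := by
    have h1 : R⁻¹ ≤ 1 := inv_le_one_of_one_le₀ hR
    calc R⁻¹ * Real.sqrt E₂ ≤ 1 * Real.sqrt E₂ := mul_le_mul_of_nonneg_right h1 (Real.sqrt_nonneg _)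
      _ = Real.sqrt E₂ * 1 := by ring
      _ ≤ Real.sqrt E₂ * R ^ (1 / 4 : ℝ) := mul_le_mul_of_nonneg_left hR14 (Real.sqrt_nonneg _)
  have hb2 : Real.sqrt (C_G * R ^ (1 / 2 : ℝ)) = Real.sqrt C_G * R ^ (1 / 4 : ℝ) := by
    rw [Real.sqrt_mul hCG, Real.sqrt_eq_rpow (R ^ (1 / 2 : ℝ)), ← Real.rpow_mul hR0.le]
    norm_num
  have hbase : C₆ * (R⁻¹ * Real.sqrt E₂ + Real.sqrt (C_G * R ^ (1 / 2 : ℝ))) ≤ N * R ^ (1 / 4 : ℝ) := by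
    rw [hb2, hN]
    have : R⁻¹ * Real.sqrt E₂ + Real.sqrt C_G * R ^ (1 / 4 : ℝ) ≤
        (Real.sqrt E₂ + Real.sqrt C_G) * R ^ (1 / 4 : ℝ) := by
      rw [add_mul]; exact add_le_add hb1 le_rfl
    calc C₆ * (R⁻¹ * Real.sqrt E₂ + Real.sqrt C_G * R ^ (1 / 4 : ℝ))
        ≤ C₆ * ((Real.sqrt E₂ + Real.sqrt C_G) * R ^ (1 / 4 : ℝ)) := mul_le_mul_of_nonneg_left this hC₆0
      _ = C₆ * (Real.sqrt E₂ + Real.sqrt C_G) * R ^ (1 / 4 : ℝ) := by ring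
  have hbase0 : 0 ≤ C₆ * (R⁻¹ * Real.sqrt E₂ + Real.sqrt (C_G * R ^ (1 / 2 : ℝ))) := by positivity
  calc (C₆ * (R⁻¹ * Real.sqrt E₂ + Real.sqrt (C_G * R ^ (1 / 2 : ℝ)))) ^ 6
      ≤ (N * R ^ (1 / 4 : ℝ)) ^ 6 := pow_le_pow_left₀ hbase0 hbase 6
    _ = N ^ 6 * R ^ (3 / 2 : ℝ) := by
        rw [mul_pow, ← Real.rpow_natCast (R ^ (1 / 4 : ℝ)), ← Real.rpow_mul hR0.le]
        norm_num

/-- **Cubic growth on balls from the weak gradient:** under the same hypotheses there is `A ≥ 0` with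
`∫_{B_L} ‖V‖³ ≤ A L^{3 − 4/3}` for `L ≥ 1` (indeed `≤ (N6 L^{3/2})^{1/4} (∫‖V‖²)^{3/4} ≲ L^{3/8}`) — the
velocity growth input (`σ = 4/3`) of the Riesz identification `pressure_ae_eq_scaleQ_of_poisson`,
which the tree obtains from the sublinear bound (`setIntegral_cube_le_of_sublinear`). [folklore] -/
theorem exists_setIntegral_cube_ball_le
    {G : EuclideanSpace ℝ (Fin 3) → EuclideanSpace ℝ (Fin 3) →L[ℝ] EuclideanSpace ℝ (Fin 3)}
    (hW : HasWeakFDerivOn (⊤ : Opens (EuclideanSpace ℝ (Fin 3))) volume V G)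
    (hVm : AEStronglyMeasurable V volume) (hGm : AEStronglyMeasurable G volume)
    (hV2 : Integrable (fun z => ‖V z‖ ^ 2) volume) {C_G : ℝ} (hCG : 0 ≤ C_G)
    (hGB : ∀ R : ℝ, 1 ≤ R →
      (∫⁻ y in ball (0 : EuclideanSpace ℝ (Fin 3)) R, ENNReal.ofReal (frobeniusNormSq (G y))) ≤
        ENNReal.ofReal (C_G * R ^ (1 / 2 : ℝ))) :
    ∃ A : ℝ, 0 ≤ A ∧ ∀ L : ℝ, 1 ≤ L →
      ∫ y in ball (0 : EuclideanSpace ℝ (Fin 3)) L, ‖V y‖ ^ 3 ≤ A * L ^ (3 - (4 / 3 : ℝ)) := by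
  obtain ⟨N6, hN60, hsix⟩ := exists_integral_norm_pow_six_ball_le hW hVm hGm hV2 hCG hGB
  set E₂ : ℝ := ∫ z, ‖V z‖ ^ 2 with hE₂
  have hE₂0 : 0 ≤ E₂ := integral_nonneg fun z => by positivity
  refine ⟨N6 ^ (1 / 4 : ℝ) * E₂ ^ (3 / 4 : ℝ), by positivity, fun L hL => ?_⟩
  have hL0 : 0 < L := one_pos.trans_le hL
  obtain ⟨hI6, hq⟩ := hsix L hL
  have hq0 : 0 ≤ ∫ y in ball (0 : EuclideanSpace ℝ (Fin 3)) L, ‖V y‖ ^ 6 :=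
    setIntegral_nonneg measurableSet_ball fun y _ => by positivity
  have he : ∫ y in ball (0 : EuclideanSpace ℝ (Fin 3)) L, ‖V y‖ ^ 2 ≤ E₂ :=
    setIntegral_le_integral hV2 (Eventually.of_forall fun y => by positivity)
  have he0 : 0 ≤ ∫ y in ball (0 : EuclideanSpace ℝ (Fin 3)) L, ‖V y‖ ^ 2 :=
    setIntegral_nonneg measurableSet_ball fun y _ => by positivity
  have h3 := setIntegral_norm_pow_three_le hVm hV2.integrableOn hI6
  have hL38 : L ^ (3 / 8 : ℝ) ≤ L ^ (3 - (4 / 3 : ℝ)) :=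
    Real.rpow_le_rpow_of_exponent_le hL (by norm_num)
  calc ∫ y in ball (0 : EuclideanSpace ℝ (Fin 3)) L, ‖V y‖ ^ 3
      ≤ (∫ y in ball (0 : EuclideanSpace ℝ (Fin 3)) L, ‖V y‖ ^ 6) ^ (1 / 4 : ℝ) *
          (∫ y in ball (0 : EuclideanSpace ℝ (Fin 3)) L, ‖V y‖ ^ 2) ^ (3 / 4 : ℝ) := h3
    _ ≤ (N6 * L ^ (3 / 2 : ℝ)) ^ (1 / 4 : ℝ) * E₂ ^ (3 / 4 : ℝ) := by
        gcongr
    _ = N6 ^ (1 / 4 : ℝ) * E₂ ^ (3 / 4 : ℝ) * L ^ (3 / 8 : ℝ) := by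
        rw [rpow_quarter_mul hN60 hL0.le]; ring
    _ ≤ N6 ^ (1 / 4 : ℝ) * E₂ ^ (3 / 4 : ℝ) * L ^ (3 - (4 / 3 : ℝ)) :=
        mul_le_mul_of_nonneg_left hL38 (by positivity)

end SobolevGrowth

end EndpointSobolev

end Summit.NavierStokesRegularity.NavierStokesRegularity.Theorems.PowerGaugeEulerLiouville
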